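import Literature.NumberTheory.GaloisRepresentations.LocalTatePairingLevelChange
import Literature.NumberTheory.GaloisRepresentations.TateDualBidualityLevels
import Literature.NumberTheory.GaloisRepresentations.RestrictedCohomologyFunctoriality
import HarnessLib

/-!
# The local Tate pairing under BIDUALITY: `⟨κ_* a, b⟩_M = ⟨a, ι_* b⟩_{M^{DD}}` at every place
# (Milne *ADT* I Prop. 0.19, Cor. 2.3; NSW (1.4.2))

Topic `NumberTheory/GaloisRepresentations`; namespace `Literature.NumberTheory.GaloisRepresentations.DiscreteGaloisModule`.
THEOREMS ONLY (no definition, no named fact, no instance, no notation, no `sorry`).  Sequel to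
`LocalTatePairingLevelChange.lean` (the same adjoint-naturality argument for a level change), -w2 g11's
`TateDualBiduality(Levels).lean` (the CANONICAL biduality maps `bidual ρ n : M →ⁱL M^{DD}`, `bidualInv ρ n hM : M^{DD} →ⁱL M`)
and `RestrictedCohomologyFunctoriality.lean` (`galoisCohomology.localization_map`).

THE MATHEMATICS.  `K` a number field, `v` any place, `M` a finite discrete Galois module killed by `n ≥ 1`, `M^D = Hom(M, μₙ)`,
`M^{DD}` its bidual, `κ = bidualInv : M^{DD} → M`, `ι = bidual : M^D → M^{DDD}` (the biduality map OF `M^D`).  The two Cartier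
pairings `M × M^D → μₙ` and `M^{DD} × M^{DDD} → μₙ` are ADJOINT along `(κ, ι)`: `f(κ ψ) = (ι f)(ψ) = ψ(f)`
(`bidual_apply`, `bidual_bidualInv`), hence so are the local cup products (`ContPairing.cupProduct_adjoint`):

* **`localTatePairing_map_bidualInv`**: `H¹(κ_v) a ∪_M b = a ∪_{M^{DD}} H¹(ι_v) b` in `H²(K_v, μₙ)` for
  `a ∈ H¹(K_v, M^{DD})`, `b ∈ H¹(K_v, M^D)`; `localTatePairingZMod_map_bidualInv` (through any `inv_v`);
* **`localTatePairingZMod_map_bidualInv_localization`**: with `b = loc_v y` for a GLOBAL `y ∈ H¹(K, M^D)` the right-hand side reads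
  `⟨a, loc_v (H¹(ι) y)⟩_{M^{DD}}` (`localization_map`) — the shape in which the tree's all-places reciprocity law (door-c5,
  presented module `M^D`, classes `y' = H¹(ι) y ∈ H¹(K, M^{DDD})`) is read back on `M`;
* `map_bidualInv_map_bidual`, `map_restrictField_bidualInv_bidual`: `H¹(κ) ∘ H¹(ι_M) = id` in degree `1`, globally and locally (for the SAME module).

Written for lane «PT-Ш-S-TC» of cell `bsd-eis` (crux `GoodLatticeBDPValue`, stmt-BirchSwinnertonDyer-19032), brick D4b/F2d: the readout
`R_v = H¹(κ_v) ∘ readoutSExt` of the `Ext` road and the dictionary between the kit's pairing `⟨·,·⟩_M` and the all-places law's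
`⟨·,·⟩_{M^{DD}}`.  HONEST FRAMING: bookkeeping; no duality theorem and no case of BSD is proved here.
AI formalisation, weaker than expert review; established only by the kernel check.

## References
* J. S. Milne, *Arithmetic Duality Theorems*, 2nd ed. (2006), Ch. I §0 Prop. 0.19, Cor. 2.3, §4 (proof of Thm. 4.10, p. 58).
  [MilneADT2006]
* J. Neukirch, A. Schmidt, K. Wingberg, *Cohomology of Number Fields*, 2nd ed. (2008), I §4 Prop. (1.4.2), (1.5.3).
  [NeukirchSchmidtWingberg2008]
-/

noncomputable section

open CategoryTheory Function NumberField IsDedekindDomain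
open scoped NumberField ContRepresentation

universe u

namespace Literature.NumberTheory.GaloisRepresentations

namespace DiscreteGaloisModule

open Field
open _root_.TopRep _root_.ContRepresentation _root_.ContinuousCohomology

variable {K : Type u} [Field K] [NumberField K]
  {M : Type u} [AddCommGroup M] [TopologicalSpace M] [DiscreteTopology M] [Finite M]
  [CharZero K] (ρ : DiscreteGaloisModule K M) (n : ℕ) [NeZero n] [Finite (TateDual K M n)]
  [Finite (TateDual K (TateDual K M n) n)] (hM : ∀ m : M, n • m = 0)

/-! ## §1 `H¹(κ) ∘ H¹(ι) = id` -/

omit [NumberField K] [Finite M] [CharZero K] [NeZero n] [Finite (TateDual K M n)] [Finite (TateDual K (TateDual K M n) n)] in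
/-- `H¹(g) (H¹(f) x) = x` whenever `g ∘ f = id` (any field, any pair of discrete Galois modules; degree `1`, on cocycles).
[cite: SerreGaloisCohomology1997, I §2.2] -/
theorem map_one_map_one_eq_self {F : Type u} [Field F] {N N' : Type u} [AddCommGroup N] [TopologicalSpace N] [DiscreteTopology N]
    [AddCommGroup N'] [TopologicalSpace N'] [DiscreteTopology N'] {τ : DiscreteGaloisModule F N} {τ' : DiscreteGaloisModule F N'}
    (f : τ.toContRepresentation →ⁱL τ'.toContRepresentation) (g : τ'.toContRepresentation →ⁱL τ.toContRepresentation)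
    (hgf : ∀ m : N, g (f m) = m) (x : galoisCohomology τ 1) :
    galoisCohomology.map g 1 (galoisCohomology.map f 1 x) = x := by
  obtain ⟨φ, rfl⟩ := oneCocycleClass_surjective _ x
  rw [galoisCohomology.map_one_oneCocycleClass, galoisCohomology.map_one_oneCocycleClass]
  exact congrArg (oneCocycleClass _) (Subtype.ext (ContinuousMap.ext fun σ => hgf (φ.1 σ)))

omit [NumberField K] [Finite (TateDual K (TateDual K M n) n)] in
/-- **`H¹(κ) (H¹(ι) x) = x`** (globally), for the biduality pair `(ι, κ) = (bidual, bidualInv)` of `M`.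
[cite: MilneADT2006, Ch. I §0, Prop. 0.19] -/
theorem map_bidualInv_map_bidual (x : galoisCohomology ρ 1) :
    galoisCohomology.map (bidualInv ρ n hM) 1 (galoisCohomology.map (bidual ρ n) 1 x) = x :=
  map_one_map_one_eq_self (bidual ρ n) (bidualInv ρ n hM) (bidualInv_bidual ρ n hM) x

omit [Finite (TateDual K (TateDual K M n) n)] in
/-- **`H¹(κ_v) (H¹(ι_v) a) = a`** at a place `v` (the restricted pair). [cite: MilneADT2006, Ch. I §0, Prop. 0.19] -/
theorem map_restrictField_bidualInv_bidual (v : Place K) (a : galoisCohomology (ρ.toLocal v) 1) :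
    galoisCohomology.map ((bidualInv ρ n hM).restrictField (Place.Completion v)) 1
        (galoisCohomology.map ((bidual ρ n).restrictField (Place.Completion v)) 1 a) = a :=
  map_one_map_one_eq_self ((bidual ρ n).restrictField (Place.Completion v))
    ((bidualInv ρ n hM).restrictField (Place.Completion v)) (fun m => bidualInv_bidual ρ n hM m) a

/-! ## §2 The local Tate pairing is adjoint along `(κ, ι)` -/

omit [NumberField K] in
/-- The Cartier pairings of `M` and of `M^{DD}` are adjoint along `(κ, ι)`: `f (κ ψ) = (ι f)(ψ)` in `μₙ` for `ψ ∈ M^{DD}`,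
`f ∈ M^D`, `κ = bidualInv` of `M`, `ι = bidual` of `M^D`. [cite: MilneADT2006, Ch. I §0, Prop. 0.19] -/
theorem tateDualEval_bidualInv_eq (ψ : TateDual K (TateDual K M n) n) (f : TateDual K M n) :
    tateDualEval K M n (bidualInv ρ n hM ψ) f =
      tateDualEval K (TateDual K (TateDual K M n) n) n ψ (bidual (ρ.tateDual n) n f) := by
  change f (bidualInv ρ n hM ψ) = bidual (ρ.tateDual n) n f ψ
  rw [bidual_apply]
  conv_rhs => rw [← bidual_bidualInv ρ n hM ψ]
  rfl

/-- **`H¹(κ_v) a ∪_M b = a ∪_{M^{DD}} H¹(ι_v) b` in `H²(K_v, μₙ)`** for `a ∈ H¹(K_v, M^{DD})`, `b ∈ H¹(K_v, M^D)`: adjoint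
naturality of the cup product along `(κ, ι)`. [cite: NeukirchSchmidtWingberg2008, I §4 Prop. (1.4.2)][cite: MilneADT2006, Ch. I, Cor. 2.3] -/
theorem localTatePairing_map_bidualInv (v : Place K)
    (a : galoisCohomology (((ρ.tateDual n).tateDual n).toLocal v) 1) (b : galoisCohomology ((ρ.tateDual n).toLocal v) 1) :
    localTatePairing ρ n v (galoisCohomology.map ((bidualInv ρ n hM).restrictField (Place.Completion v)) 1 a) b =
      localTatePairing ((ρ.tateDual n).tateDual n) n v a
        (galoisCohomology.map ((bidual (ρ.tateDual n) n).restrictField (Place.Completion v)) 1 b) := by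
  haveI : CompactSpace (absoluteGaloisGroup (Place.Completion (K := K) v)) := absoluteGaloisGroup_compactSpace _
  exact ContPairing.cupProduct_adjoint (P₁ := tateDualPairingLocal ((ρ.tateDual n).tateDual n) n v)
    (P₂ := tateDualPairingLocal ρ n v)
    (homOfIntertwining ((bidualInv ρ n hM).restrictField (Place.Completion v)))
    (homOfIntertwining ((bidual (ρ.tateDual n) n).restrictField (Place.Completion v)))
    (fun ψ f => tateDualEval_bidualInv_eq ρ n hM ψ f) a b

/-- The same through an additive `inv_v : H²(K_v, μₙ) → ℤ/n`: **`⟨H¹(κ_v) a, b⟩_M = ⟨a, H¹(ι_v) b⟩_{M^{DD}}`.**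
[cite: NeukirchSchmidtWingberg2008, I §4 Prop. (1.4.2)][cite: MilneADT2006, Ch. I, Cor. 2.3] -/
theorem localTatePairingZMod_map_bidualInv (v : Place K)
    (inv : galoisCohomology ((mu K n).toLocal v) 2 →+ ZMod n)
    (a : galoisCohomology (((ρ.tateDual n).tateDual n).toLocal v) 1) (b : galoisCohomology ((ρ.tateDual n).toLocal v) 1) :
    localTatePairingZMod ρ n v inv (galoisCohomology.map ((bidualInv ρ n hM).restrictField (Place.Completion v)) 1 a) b =
      localTatePairingZMod ((ρ.tateDual n).tateDual n) n v inv a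
        (galoisCohomology.map ((bidual (ρ.tateDual n) n).restrictField (Place.Completion v)) 1 b) := by
  rw [localTatePairingZMod_apply, localTatePairingZMod_apply, localTatePairing_map_bidualInv]

/-- **With a GLOBAL second argument**: `⟨H¹(κ_v) a, loc_v y⟩_M = ⟨a, loc_v (H¹(ι) y)⟩_{M^{DD}}` for `y ∈ H¹(K, M^D)` — the local term
of the tree's all-places reciprocity law for the presented module `M^D` at the class `y' = H¹(ι) y ∈ H¹(K, M^{DDD})`, read on `M`.
[cite: MilneADT2006, Ch. I §4 (proof of Thm. 4.10, p. 58)][cite: NeukirchSchmidtWingberg2008, I §4 Prop. (1.4.2), (1.5.3)] -/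
theorem localTatePairingZMod_map_bidualInv_localization (v : Place K)
    (inv : galoisCohomology ((mu K n).toLocal v) 2 →+ ZMod n)
    (a : galoisCohomology (((ρ.tateDual n).tateDual n).toLocal v) 1) (y : galoisCohomology (ρ.tateDual n) 1) :
    localTatePairingZMod ρ n v inv (galoisCohomology.map ((bidualInv ρ n hM).restrictField (Place.Completion v)) 1 a)
        (galoisCohomology.localization (ρ.tateDual n) v 1 y) =
      localTatePairingZMod ((ρ.tateDual n).tateDual n) n v inv a
        (galoisCohomology.localization (((ρ.tateDual n).tateDual n).tateDual n) v 1
          (galoisCohomology.map (bidual (ρ.tateDual n) n) 1 y)) := by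
  rw [localTatePairingZMod_map_bidualInv, galoisCohomology.localization_map]

end DiscreteGaloisModule

end Literature.NumberTheory.GaloisRepresentations

end
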